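/- Copyright: the b2b-balaban cell (near-miss cell 7), T⁴-continuum fan-out, NE7b CRUX team (2), leaf lineage
t4-ne7b-formalise-leaf-02 (gen 29) on the row-NE7b OWNER t4-ne7b-p1 g47's INTERFACE REQUEST NE7b IR-47-1 «DISTINCT AND BOXED
ON PASS V» (R-OWNER-47-2 (B), journal l.31988) as corrected by the located finding F-ne7bleaf02g29-1 (journal l.32013;
leaf-05's PASS + CONCUR W-ne7bleaf05-g31-1, l.32044) — PART 1 of 3, the generic birth lemmas.  Released under the licence
of the surrounding project. -/
import Summits.QuantumFields.BalabanUV.T4Continuum.Support.HistoryGenealogyPedigreeHead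
import Summits.QuantumFields.BalabanUV.T4Continuum.Support.HistorySiblingEntropySortPhys

/-!
# THE BIRTHS OF A COMPONENT'S `PGen` (pedigree brick): new regions of their steps, name-disjoint across components

Summits-side support leaf of the T⁴-continuum cell (rung (B)+1 on a FINITE torus only; NOT infinite volume, NOT the
mass gap, NOT the Clay statement; NOT a proof of the spine estimate NE7b, which is the cell's OWN estimate, NOT PRINTED
and NOT PROVED).  [folklore] finite combinatorics over the pedigree bricks (`HistoryGenealogyPedigree`: `pedOf`,
`OrderOK`, `toPGen_zero`∕`toPGen_succ`, `mem_news_of_inr_mem_ord`∕`mem_parts_of_inl_mem_ord`; `…PedigreeHead`: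
`ord_ne_nil`, `rights_ord_zero_ne_nil`), the extraction's `ComponentHistory.WF` (`parts_sub`, `news_sub`, `parts_disj`,
`news_disj`) and the census carrier's `PGen.pbirths` (`HistorySiblingEntropySortPhys`); nothing printed is asserted,
no `def … : Prop` fact of Bałaban's, no cite-tagged hypothesis, zero `sorry`.

WHY.  The row-NE7b OWNER's INTERFACE REQUEST IR-47-1 asks the (α) assembly's two per-component reading clauses
`boxedBirths`∕`disjointJoins` of the VS-witness to be DERIVED at the pass-V reading; both are statements about the
PHYSICAL BIRTHS `pbirths` of the genealogy `(pedOf H rnw ord).toPGen id (j, c)` of a live component, and both reduce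
(finding F-ne7bleaf02g29-1, corrected forms) to the two facts below.  PART 2 (`HistoryRealiseDistinctGuarded`) is the
label-guarded display; PART 3 (`HistoryGenealogyJunctionVDistinct`) instantiates on pass V.

WHAT.  §1 `mem_sum_map` (membership in a list-indexed sum of multisets), `pbirths_joinP_of_ne_nil`, `pbirths_oldPart`;
the level-wise shape of the births under an admissible order: `mem_pbirths_toPGen_zero` (level `0`: `((0,0,cls n), n)`
for a listed new region), `mem_pbirths_toPGen_succ` (level `j+1`: a birth of a listed old part's `PGen`, or
`((j+1,0,cls n), n)` for a listed new region).  §2 **LEMMA B `mem_newReg_of_mem_pbirths_toPGen`** — every birth `b` of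
`(pedOf H rnw ord).toPGen id (j, c)` (`c ∈ comp j`, `WF`, `OrderOK`) has `PEv.step b.1 ≤ j`, payload
`b.2 ∈ H.newReg (PEv.step b.1)` and label `b.1 = (step, 0, cls b.2)`.  §3 **LEMMA D `pbirths_name_ne_of_ne`** —
for `c ≠ c'` in `comp j` no birth of `c`'s `PGen` has the same `(step, payload)` as a birth of `c'`'s
(`WF.parts_disj`∕`news_disj`, induction on the level).

HONEST.  Bookkeeping over OUR carriers; proves nothing of Bałaban's; NE7b NOT proved; spine 0∕9.
HONEST DEPENDENCY (cell): continuum YM on T⁴ ⇐ BetaPertH ∧ nine spine estimates (0/9 proved); BetaPertH ⇐ (D1) ∧ (D4)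
∧ CAP+tail; G-an2-4 gates asym, D1 and NE2/3/4.  This file changes none of it. -/

open Finset
open Literature.MathematicalPhysics.QuantumFieldTheory.Balaban1983to89
open T4PersistenceDictionary
open Summit.QuantumFields.BalabanUV.T4Continuum.HistoryAdmissible
open Summit.QuantumFields.BalabanUV.T4Continuum.HistoryGen
open Summit.QuantumFields.BalabanUV.T4Continuum.HistoryGenealogyExtraction

namespace Summit.QuantumFields.BalabanUV.T4Continuum.HistoryGenealogyPedigree

noncomputable section

/-! ## §1 The level-wise shape of the births of a component's `PGen` -/

section Births

variable {γ : Type*} [DecidableEq γ] [Inhabited γ] {H : ComponentHistory γ} {rnw : ℕ → γ → Bool}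
  {ord : ℕ → γ → List (γ ⊕ γ)}

/-- membership in a list-indexed sum of multisets [folklore] -/
theorem mem_sum_map {ι α : Type*} (f : ι → Multiset α) (a : α) :
    ∀ L : List ι, a ∈ (L.map f).sum ↔ ∃ x ∈ L, a ∈ f x
  | [] => by simp
  | x :: L => by
      rw [List.map_cons, List.sum_cons, Multiset.mem_add, mem_sum_map f a L]
      simp only [List.mem_cons, exists_eq_or_imp]

/-- the physical births of a NONEMPTY join of part `PGen`s: the sum over the parts (order-free) [folklore] -/
theorem pbirths_joinP_of_ne_nil {α π δ : Type*} [Inhabited δ] (P : Pedigree α π) (c : α) {L : List (PGen δ)}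
    (hL : L ≠ []) : (P.joinP c L).pbirths = (L.map PGen.pbirths).sum := by
  obtain ⟨A, As, rfl⟩ := List.exists_cons_of_ne_nil hL
  simp only [Pedigree.joinP, PGen.pbirths_chainJoin, List.map_cons, List.sum_cons]

/-- the births of an old part's `PGen` do not see its renewal flag [folklore] -/
theorem pbirths_oldPart {δ : Type*} (b : Bool) (G : PGen δ) (j : ℕ) :
    (if b = true then PGen.renew G j else G).pbirths = G.pbirths := by
  cases b <;> rfl

/-- **BIRTHS AT LEVEL `0`**: a birth of the `PGen` of a level-`0` component is `((0, 0, cls n), n)` for a listed new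
region `n` (admissible order, `WF`). [folklore] -/
theorem mem_pbirths_toPGen_zero (hW : H.WF) (hO : OrderOK H ord) {c : γ} (hc : c ∈ H.comp 0)
    {b : PEv × γ} (hb : b ∈ ((pedOf H rnw ord).toPGen id (0, c)).pbirths) :
    ∃ n, Sum.inr n ∈ ord 0 c ∧ b = (((0, 0, H.cls n) : PEv), n) := by
  have hne : (rights (ord 0 c)).map (fun n => PGen.birth 0 (H.cls n) (id n)) ≠ [] := by
    simpa using rights_ord_zero_ne_nil hW hO hc
  rw [toPGen_zero H rnw ord id hc, pbirths_joinP_of_ne_nil _ _ hne, List.map_map] at hb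
  obtain ⟨n, hn, hbn⟩ := (mem_sum_map _ _ _).1 hb
  simp only [Function.comp, PGen.pbirths_birth, Multiset.mem_singleton] at hbn
  exact ⟨n, (mem_rights_iff n _).1 hn, hbn⟩

/-- **BIRTHS AT A SUCCESSOR LEVEL**: a birth of the `PGen` of a level-`(j+1)` component is a birth of a listed old
part's `PGen`, or `((j+1, 0, cls n), n)` for a listed new region `n`. [folklore] -/
theorem mem_pbirths_toPGen_succ (hW : H.WF) (hO : OrderOK H ord) {j : ℕ} {c : γ} (hc : c ∈ H.comp (j + 1))
    {b : PEv × γ} (hb : b ∈ ((pedOf H rnw ord).toPGen id (j + 1, c)).pbirths) :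
    (∃ p, Sum.inl p ∈ ord (j + 1) c ∧ b ∈ ((pedOf H rnw ord).toPGen id (j, p)).pbirths) ∨
      ∃ n, Sum.inr n ∈ ord (j + 1) c ∧ b = (((j + 1, 0, H.cls n) : PEv), n) := by
  have hne : ((ord (j + 1) c).map fun q =>
      Sum.elim (fun p => if rnw j p = true then PGen.renew ((pedOf H rnw ord).toPGen id (j, p)) j
          else (pedOf H rnw ord).toPGen id (j, p))
        (fun n => PGen.birth (j + 1) (H.cls n) (id n)) q) ≠ [] := by
    simpa using ord_ne_nil hW hO hc
  rw [toPGen_succ H rnw ord id hc, pbirths_joinP_of_ne_nil _ _ hne, List.map_map] at hb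
  obtain ⟨q, hq, hbq⟩ := (mem_sum_map _ _ _).1 hb
  cases q with
  | inl p =>
      left
      refine ⟨p, hq, ?_⟩
      simpa only [Function.comp, Sum.elim_inl, pbirths_oldPart] using hbq
  | inr n =>
      right
      simp only [Function.comp, Sum.elim_inr, PGen.pbirths_birth, Multiset.mem_singleton] at hbq
      exact ⟨n, hq, hbq⟩

/-! ## §2 LEMMA B: the births are print's new regions of their steps -/

/-- **LEMMA B — THE BIRTHS OF A COMPONENT'S `PGen` ARE PRINT'S NEW REGIONS OF THEIR STEPS**: under `WF` and an
admissible order, every birth `b` of `(pedOf H rnw ord).toPGen id (j, c)` (`c ∈ comp j`) has step `≤ j`, payload a new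
region of that step, and the birth label `(step, 0, cls payload)`. [folklore] -/
theorem mem_newReg_of_mem_pbirths_toPGen (hW : H.WF) (hO : OrderOK H ord) :
    ∀ (j : ℕ) (c : γ), c ∈ H.comp j → ∀ b ∈ ((pedOf H rnw ord).toPGen id (j, c)).pbirths,
      PEv.step b.1 ≤ j ∧ b.2 ∈ H.newReg (PEv.step b.1) ∧ b.1 = ((PEv.step b.1, 0, H.cls b.2) : PEv)
  | 0, c, hc, b, hb => by
      obtain ⟨n, hn, rfl⟩ := mem_pbirths_toPGen_zero hW hO hc hb
      exact ⟨le_rfl, hW.news_sub 0 c hc n (mem_news_of_inr_mem_ord hO hc hn), rfl⟩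
  | j + 1, c, hc, b, hb => by
      rcases mem_pbirths_toPGen_succ hW hO hc hb with ⟨p, hp, hb'⟩ | ⟨n, hn, rfl⟩
      · have hpc : p ∈ H.comp j := hW.parts_sub j c hc p (mem_parts_of_inl_mem_ord hO hc hp)
        obtain ⟨h1, h2, h3⟩ := mem_newReg_of_mem_pbirths_toPGen hW hO j p hpc b hb'
        exact ⟨h1.trans (Nat.le_succ j), h2, h3⟩
      · exact ⟨le_rfl, hW.news_sub (j + 1) c hc n (mem_news_of_inr_mem_ord hO hc hn), rfl⟩

/-! ## §3 LEMMA D: distinct components of one level have name-disjoint births -/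

/-- **LEMMA D — DISTINCT COMPONENTS OF ONE LEVEL HAVE NAME-DISJOINT BIRTHS**: for `c ≠ c'` in `comp j`, no birth of
`c`'s `PGen` has the same (step, payload) as a birth of `c'`'s (`WF.parts_disj`∕`news_disj`, induction on the level).
[folklore] -/
theorem pbirths_name_ne_of_ne (hW : H.WF) (hO : OrderOK H ord) :
    ∀ (j : ℕ) (c c' : γ), c ∈ H.comp j → c' ∈ H.comp j → c ≠ c' →
      ∀ b ∈ ((pedOf H rnw ord).toPGen id (j, c)).pbirths, ∀ b' ∈ ((pedOf H rnw ord).toPGen id (j, c')).pbirths,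
        ¬ (PEv.step b.1 = PEv.step b'.1 ∧ b.2 = b'.2)
  | 0, c, c', hc, hc', hne, b, hb, b', hb' => by
      obtain ⟨n, hn, rfl⟩ := mem_pbirths_toPGen_zero hW hO hc hb
      obtain ⟨n', hn', rfl⟩ := mem_pbirths_toPGen_zero hW hO hc' hb'
      rintro ⟨-, h⟩
      have hnn : n = n' := h
      subst hnn
      have hd := hW.news_disj 0 c c' hc hc' hne
      rw [Finset.disjoint_left] at hd
      exact hd (List.mem_toFinset.2 (mem_news_of_inr_mem_ord hO hc hn))
        (List.mem_toFinset.2 (mem_news_of_inr_mem_ord hO hc' hn'))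
  | j + 1, c, c', hc, hc', hne, b, hb, b', hb' => by
      rcases mem_pbirths_toPGen_succ hW hO hc hb with ⟨p, hp, hbp⟩ | ⟨n, hn, rfl⟩ <;>
        rcases mem_pbirths_toPGen_succ hW hO hc' hb' with ⟨p', hp', hbp'⟩ | ⟨n', hn', rfl⟩
      · -- old ∕ old: distinct parts (disjoint part lists), induction
        have hpm := mem_parts_of_inl_mem_ord hO hc hp
        have hpm' := mem_parts_of_inl_mem_ord hO hc' hp'
        have hpp : p ≠ p' := by
          intro h
          have hd := hW.parts_disj j c c' hc hc' hne
          rw [Finset.disjoint_left] at hd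
          exact hd (List.mem_toFinset.2 hpm) (h ▸ List.mem_toFinset.2 hpm')
        exact pbirths_name_ne_of_ne hW hO j p p' (hW.parts_sub j c hc p hpm) (hW.parts_sub j c' hc' p' hpm') hpp
          b hbp b' hbp'
      · -- old ∕ new: steps differ
        rintro ⟨h, -⟩
        have h1 := (mem_newReg_of_mem_pbirths_toPGen hW hO j p
          (hW.parts_sub j c hc p (mem_parts_of_inl_mem_ord hO hc hp)) b hbp).1
        simp only [PEv.step_mk] at h
        omega
      · -- new ∕ old: steps differ
        rintro ⟨h, -⟩
        have h1 := (mem_newReg_of_mem_pbirths_toPGen hW hO j p'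
          (hW.parts_sub j c' hc' p' (mem_parts_of_inl_mem_ord hO hc' hp')) b' hbp').1
        simp only [PEv.step_mk] at h
        omega
      · -- new ∕ new: disjoint news lists
        rintro ⟨-, h⟩
        have hnn : n = n' := h
        subst hnn
        have hd := hW.news_disj (j + 1) c c' hc hc' hne
        rw [Finset.disjoint_left] at hd
        exact hd (List.mem_toFinset.2 (mem_news_of_inr_mem_ord hO hc hn))
          (List.mem_toFinset.2 (mem_news_of_inr_mem_ord hO hc' hn'))

end Births

end

end Summit.QuantumFields.BalabanUV.T4Continuum.HistoryGenealogyPedigree
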